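import Literature.Analysis.FluidPDE.TorusLinearisedNSH1Balance
import HarnessLib

/-!
# The time derivative of classical Navier–Stokes solutions on the flat torus: incompressibility
# and the `L²` speed bound

Analysis/FluidPDE proof file (theorems only; no definitions, no named facts). For a classical
solution `(u, p)` of the forced incompressible Navier–Stokes system on `T^d × [a, b]`
(`Torus.IsClassicalNSSolutionOn (Icc a b) ν f u p`), the one-sided time derivative
`∂ₜu = Torus.timeDerivWithin (Icc a b) u` is

* divergence free (`Torus.IsClassicalNSSolutionOn.isDivFree_timeDerivWithin`: `div ∂ₜu = ∂ₜ div u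
  = 0`, by `∂ₜ∂ᵢ = ∂ᵢ∂ₜ`, `Torus.timeDerivWithin_partialDeriv_comm`), hence `L²`-orthogonal to the
  pressure gradient, so that
* its `L²` norm is controlled by the Leray-projected right-hand side
  (`Torus.IsClassicalNSSolutionOn.integral_norm_timeDerivWithin_sq_le`):
  `∫ ‖∂ₜu‖² ≤ ∫ ‖νΔu + f − (u·∇)u‖² ≤ 3 (ν² ∫ ‖Δu‖² + ∫ ‖f‖² + ∫ ‖(u·∇)u‖²)`, and with a sup
  bound `‖u‖ ≤ M` (`Torus.IsClassicalNSSolutionOn.integral_norm_timeDerivWithin_sq_le_of_norm_le`)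
  `∫ ‖∂ₜu‖² ≤ 3 (ν² ‖Δu‖₂² + ‖f‖₂² + |d| M² ‖∇u‖₂²)`.

This is the "speed" bound `‖du/dt‖_H ≤ ν|Au| + |f| + |B(u, u)|` of the functional form
`du/dt + νAu + B(u, u) = Pf` of the equations (Constantin–Foias 1988, Ch. 5 (5.9)–(5.10);
Foias–Manley–Rosa–Temam 2001, Ch. II (2.15)); along a compact invariant set of strong solutions
bounded in `H²` it bounds `sup ‖∂ₜu‖₂`, i.e. the Lipschitz constant in time of the trajectories
(used by the decoding step of closing arguments for the Navier–Stokes semiflow). Deliberately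
NOT here: higher time derivatives, time-Hölder/Lipschitz estimates of `t ↦ u(t)` in `L²`.

## Mathlib / tree search

Tree (reused): `Torus.timeDerivWithin_partialDeriv_comm`, `Torus.timeDerivWithin_clm_comp`,
`Torus.timeDerivWithin_finset_sum` (`TorusInverseLaplacianCalculus`),
`Torus.divergence_eq_sum_partialDeriv_apply` (`TorusEnstrophyOrthogonality`),
`Torus.integral_inner_gradient_eq_zero_of_isDivFree` (`TorusCalculusProofs`),
`Torus.integral_norm_sq_convect_le_of_norm_le` (`TorusLinearisedNSH1Balance`). Searched
`IsDivFree (timeDerivWithin`, `integral_norm_timeDerivWithin_sq`: only an `ℝ³` interior-time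
version (`isDivFree_timeDerivWithin` of `EnstrophyGronwall`) and summit-local copies on `Ici 0`.

## References

* P. Constantin, C. Foias, *Navier–Stokes Equations*, Univ. Chicago Press 1988, Ch. 5,
  (5.9)–(5.10) (the functional form `u' + νAu + B(u) = f`). [ConstantinFoiasNSE1988]
* C. Foias, O. Manley, R. Rosa, R. Temam, *Navier–Stokes Equations and Turbulence*, CUP 2001,
  Ch. II §2 (2.15). [FoiasManleyRosaTemam2001]
-/

noncomputable section

open MeasureTheory Set Function Filter
open scoped ContDiff InnerProductSpace RealInnerProductSpace Topology

namespace Literature.Analysis.FluidPDE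

open Literature.Analysis.FunctionSpaces

variable {d : Type*} [Fintype d] [DecidableEq d]

variable {a b ν : ℝ} {f u : ℝ → UnitAddTorus d → EuclideanSpace ℝ d} {p : ℝ → UnitAddTorus d → ℝ}

/-- **The time derivative of a classical solution is divergence free**: for a classical solution
on `[a, b] × T^d`, `a < b`, and `t ∈ [a, b]`, `div (∂ₜu(t)) = 0` — `div ∂ₜu = ∑ᵢ (∂ᵢ∂ₜu)ᵢ =
∑ᵢ (∂ₜ∂ᵢu)ᵢ = ∂ₜ (div u) = 0` (one-sided time derivative within `[a, b]`; only joint smoothness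
and incompressibility of `u` are used). [folklore] -/
theorem _root_.Literature.Analysis.FunctionSpaces.Torus.IsClassicalNSSolutionOn.isDivFree_timeDerivWithin
    (h : Torus.IsClassicalNSSolutionOn (Icc a b) ν f u p) (hab : a < b) {t : ℝ} (ht : t ∈ Icc a b) :
    Torus.IsDivFree (Torus.timeDerivWithin (Icc a b) u t) := by
  intro x
  have hS : UniqueDiffOn ℝ (Icc a b) := uniqueDiffOn_Icc hab
  have hu : Torus.IsSmoothSpaceTimeOn (Icc a b) u := h.smooth_velocity
  have hA : Torus.IsSmooth (Torus.timeDerivWithin (Icc a b) u t) := hu.isSmooth_timeDerivWithin hS ht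
  rw [Torus.divergence_eq_sum_partialDeriv_apply (hA.isContDiff (by simp))]
  -- `(∂ᵢ∂ₜu)ᵢ = ∂ₜ ((∂ᵢu)ᵢ)`
  have e1 : ∀ i, Torus.partialDeriv i (Torus.timeDerivWithin (Icc a b) u t) x i =
      Torus.timeDerivWithin (Icc a b) (fun s y => Torus.partialDeriv i (u s) y i) t x := by
    intro i
    have hk : Torus.timeDerivWithin (Icc a b) (fun s y => Torus.partialDeriv i (u s) y i) t x =
        (Torus.timeDerivWithin (Icc a b) (fun s => Torus.partialDeriv i (u s)) t x) i :=
      Torus.timeDerivWithin_clm_comp (hu.partialDeriv hS i) hS (EuclideanSpace.proj i) ht x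
    rw [hk, Torus.timeDerivWithin_partialDeriv_comm hab hu ht i x]
  simp only [e1]
  -- `∑ᵢ ∂ₜ((∂ᵢu)ᵢ) = ∂ₜ (∑ᵢ (∂ᵢu)ᵢ) = ∂ₜ (div u) = 0` on `[a, b]`
  have hsum : Torus.timeDerivWithin (Icc a b) (fun s y => ∑ i, Torus.partialDeriv i (u s) y i) t x =
      ∑ i, Torus.timeDerivWithin (Icc a b) (fun s y => Torus.partialDeriv i (u s) y i) t x :=
    Torus.timeDerivWithin_finset_sum Finset.univ (U := fun i s y => Torus.partialDeriv i (u s) y i)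
      (fun i _ => (hu.partialDeriv hS i).apply i) hS ht x
  rw [← hsum]
  have e2 : ∀ s ∈ Icc a b, (fun y => ∑ i, Torus.partialDeriv i (u s) y i) = fun _ => (0 : ℝ) := by
    intro s hs
    funext y
    rw [← Torus.divergence_eq_sum_partialDeriv_apply ((hu.isSmooth_slice hs).isContDiff (by simp))]
    exact h.divFree s hs y
  unfold Torus.timeDerivWithin
  rw [derivWithin_congr (f := fun s => (0 : ℝ)) (fun s hs => congrFun (e2 s hs) x) (congrFun (e2 t ht) x)]
  simp

/-- `‖a + b - c‖² ≤ 3 (‖a‖² + ‖b‖² + ‖c‖²)` in a normed group. [folklore] -/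
private theorem norm_add_sub_sq_le_three {G : Type*} [NormedAddCommGroup G] (x y z : G) :
    ‖x + y - z‖ ^ 2 ≤ 3 * (‖x‖ ^ 2 + ‖y‖ ^ 2 + ‖z‖ ^ 2) := by
  have h := (norm_sub_le (x + y) z).trans (add_le_add (norm_add_le x y) le_rfl)
  nlinarith [norm_nonneg (x + y - z), norm_nonneg x, norm_nonneg y, norm_nonneg z,
    sq_nonneg (‖x‖ - ‖y‖), sq_nonneg (‖y‖ - ‖z‖), sq_nonneg (‖x‖ - ‖z‖)]

/-- **The `L²` speed bound.** For a classical solution on `[a, b] × T^d`, `a < b`, and `t ∈ [a, b]`,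
`∫ ‖∂ₜu(t)‖² ≤ 3 (ν² ∫ ‖Δu(t)‖² + ∫ ‖f(t)‖² + ∫ ‖(u·∇)u(t)‖²)`: by the momentum equation
`∂ₜu = (νΔu + f − (u·∇)u) − ∇p`, and `∫ ⟪∂ₜu, ∇p⟫ = 0` because `∂ₜu` is divergence free
(`isDivFree_timeDerivWithin`), so `∫ ‖∂ₜu‖² = ∫ ⟪∂ₜu, νΔu + f − (u·∇)u⟫ ≤ ∫ ‖νΔu + f − (u·∇)u‖²`
(Cauchy–Schwarz/Young pointwise) — the norm of `du/dt = −νAu − B(u,u) + Pf` in `H`.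
[cite: ConstantinFoiasNSE1988, Ch. 5 (5.9)–(5.10)] -/
theorem _root_.Literature.Analysis.FunctionSpaces.Torus.IsClassicalNSSolutionOn.integral_norm_timeDerivWithin_sq_le
    (h : Torus.IsClassicalNSSolutionOn (Icc a b) ν f u p) (hab : a < b) {t : ℝ} (ht : t ∈ Icc a b) :
    ∫ x, ‖Torus.timeDerivWithin (Icc a b) u t x‖ ^ 2 ≤
      3 * (ν ^ 2 * (∫ x, ‖Torus.laplacian (u t) x‖ ^ 2) + (∫ x, ‖f t x‖ ^ 2) +
        ∫ x, ‖Torus.convect (u t) (u t) x‖ ^ 2) := by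
  have hS : UniqueDiffOn ℝ (Icc a b) := uniqueDiffOn_Icc hab
  have hu : Torus.IsSmoothSpaceTimeOn (Icc a b) u := h.smooth_velocity
  have hut : Torus.IsSmooth (u t) := hu.isSmooth_slice ht
  have hpt : Torus.IsSmooth (p t) := h.smooth_pressure.isSmooth_slice ht
  have hA : Torus.IsSmooth (Torus.timeDerivWithin (Icc a b) u t) := hu.isSmooth_timeDerivWithin hS ht
  have hΔ : Torus.IsSmooth (Torus.laplacian (u t)) := hut.laplacian
  have hB : Torus.IsSmooth (Torus.convect (u t) (u t)) := hut.convect hut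
  have hft : Torus.IsSmooth (f t) := by
    have hfun : f t = fun x => Torus.timeDerivWithin (Icc a b) u t x +
        Torus.convect (u t) (u t) x - ν • Torus.laplacian (u t) x + Torus.gradient (p t) x := by
      funext x
      rw [h.momentum t ht x]
      abel
    rw [hfun]
    exact ((hA.add hB).sub (hΔ.smul ν)).add hpt.gradient
  -- the Leray-projected right-hand side `R = νΔu + f − (u·∇)u`
  set A : UnitAddTorus d → EuclideanSpace ℝ d := Torus.timeDerivWithin (Icc a b) u t with hAdef
  set R : UnitAddTorus d → EuclideanSpace ℝ d :=
    fun x => ν • Torus.laplacian (u t) x + f t x - Torus.convect (u t) (u t) x with hRdef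
  have hR : Torus.IsSmooth R := ((hΔ.smul ν).add hft).sub hB
  have hAR : ∀ x, A x = R x - Torus.gradient (p t) x := by
    intro x
    have hm := h.momentum t ht x
    calc A x = (ν • Torus.laplacian (u t) x - Torus.gradient (p t) x + f t x) - Torus.convect (u t) (u t) x := by
          rw [← hm]; simp only [hAdef]; abel
      _ = R x - Torus.gradient (p t) x := by simp only [hRdef]; abel
  -- `∫ ‖A‖² = ∫ ⟪A, R⟫`
  have hpres : ∫ x, ⟪Torus.gradient (p t) x, A x⟫ = 0 :=
    Torus.integral_inner_gradient_eq_zero_of_isDivFree hA hpt (h.isDivFree_timeDerivWithin hab ht)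
  have iAR : Integrable (fun x => ⟪A x, R x⟫) volume := (hA.inner hR).integrable
  have iAG : Integrable (fun x => ⟪A x, Torus.gradient (p t) x⟫) volume := (hA.inner hpt.gradient).integrable
  have hE : ∫ x, ‖A x‖ ^ 2 = ∫ x, ⟪A x, R x⟫ := by
    have h1 : (fun x => ‖A x‖ ^ 2) = fun x => ⟪A x, R x⟫ - ⟪A x, Torus.gradient (p t) x⟫ := by
      funext x
      rw [← inner_sub_right, ← hAR x, real_inner_self_eq_norm_sq]
    have h2 : ∫ x, ⟪A x, Torus.gradient (p t) x⟫ = 0 := by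
      rw [← hpres]
      exact integral_congr_ae (ae_of_all _ fun x => real_inner_comm _ _)
    rw [h1, integral_sub iAR iAG, h2, sub_zero]
  -- Young: `⟪A, R⟫ ≤ ½‖A‖² + ½‖R‖²`, so `∫ ‖A‖² ≤ ∫ ‖R‖²`
  have iA2 : Integrable (fun x => ‖A x‖ ^ 2) volume := hA.norm_sq.integrable
  have iR2 : Integrable (fun x => ‖R x‖ ^ 2) volume := hR.norm_sq.integrable
  have hY : ∫ x, ⟪A x, R x⟫ ≤ ∫ x, (2⁻¹ * ‖A x‖ ^ 2 + 2⁻¹ * ‖R x‖ ^ 2) := by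
    refine integral_mono iAR ((iA2.const_mul _).add (iR2.const_mul _)) fun x => ?_
    have h1 : ⟪A x, R x⟫ ≤ ‖A x‖ * ‖R x‖ := real_inner_le_norm _ _
    nlinarith [sq_nonneg (‖A x‖ - ‖R x‖)]
  rw [integral_add (iA2.const_mul _) (iR2.const_mul _), integral_const_mul, integral_const_mul] at hY
  have hAR2 : ∫ x, ‖A x‖ ^ 2 ≤ ∫ x, ‖R x‖ ^ 2 := by linarith [hE, hY]
  -- `‖R‖² ≤ 3 (ν²‖Δu‖² + ‖f‖² + ‖B‖²)`
  have iL : Integrable (fun x => ‖Torus.laplacian (u t) x‖ ^ 2) volume := hΔ.norm_sq.integrable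
  have iF : Integrable (fun x => ‖f t x‖ ^ 2) volume := hft.norm_sq.integrable
  have iB : Integrable (fun x => ‖Torus.convect (u t) (u t) x‖ ^ 2) volume := hB.norm_sq.integrable
  have hR3 : ∫ x, ‖R x‖ ^ 2 ≤ ∫ x, 3 * (ν ^ 2 * ‖Torus.laplacian (u t) x‖ ^ 2 + ‖f t x‖ ^ 2 +
      ‖Torus.convect (u t) (u t) x‖ ^ 2) := by
    have i3 : Integrable (fun x => ν ^ 2 * ‖Torus.laplacian (u t) x‖ ^ 2 + ‖f t x‖ ^ 2 +
        ‖Torus.convect (u t) (u t) x‖ ^ 2) volume := ((iL.const_mul _).add iF).add iB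
    refine integral_mono iR2 (i3.const_mul _) fun x => ?_
    have h1 := norm_add_sub_sq_le_three (ν • Torus.laplacian (u t) x) (f t x) (Torus.convect (u t) (u t) x)
    rw [norm_smul, mul_pow, Real.norm_eq_abs, sq_abs] at h1
    exact h1
  have i12 : Integrable (fun x => ν ^ 2 * ‖Torus.laplacian (u t) x‖ ^ 2 + ‖f t x‖ ^ 2) volume :=
    (iL.const_mul _).add iF
  have iL' : Integrable (fun x => ν ^ 2 * ‖Torus.laplacian (u t) x‖ ^ 2) volume := iL.const_mul _
  rw [integral_const_mul, integral_add i12 iB, integral_add iL' iF, integral_const_mul] at hR3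
  exact hAR2.trans hR3

/-- **The `L²` speed bound under a sup bound of the velocity**: if moreover `‖u(t, x)‖ ≤ M` on
`T^d`, then `∫ ‖∂ₜu(t)‖² ≤ 3 (ν² ∫ ‖Δu(t)‖² + ∫ ‖f(t)‖² + |d| M² ‖∇u(t)‖₂²)`
(`∫ ‖(u·∇)u‖² ≤ |d| M² ‖∇u‖₂²`, `Torus.integral_norm_sq_convect_le_of_norm_le`). Along a compact
invariant set of strong solutions bounded in `H²` this bounds the speed `sup ‖∂ₜu‖₂`. [folklore] -/
theorem _root_.Literature.Analysis.FunctionSpaces.Torus.IsClassicalNSSolutionOn.integral_norm_timeDerivWithin_sq_le_of_norm_le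
    (h : Torus.IsClassicalNSSolutionOn (Icc a b) ν f u p) (hab : a < b) {t : ℝ} (ht : t ∈ Icc a b)
    {M : ℝ} (hM : ∀ x, ‖u t x‖ ≤ M) :
    ∫ x, ‖Torus.timeDerivWithin (Icc a b) u t x‖ ^ 2 ≤
      3 * (ν ^ 2 * (∫ x, ‖Torus.laplacian (u t) x‖ ^ 2) + (∫ x, ‖f t x‖ ^ 2) +
        Fintype.card d * M ^ 2 * Torus.gradNormSq (u t)) := by
  have h1 := h.integral_norm_timeDerivWithin_sq_le hab ht
  have h2 := Torus.integral_norm_sq_convect_le_of_norm_le (u := u t) (h.smooth_velocity.isSmooth_slice ht) hM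
  linarith

end Literature.Analysis.FluidPDE

end
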